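import Summits.Ventures.HodgeRepro2.T5LevelIdempotent

/-!
# The level idempotent is self-adjoint for invariant pairings (Tier-5 kernel support, p8)

For a `K`-invariant bilinear pairing `B : V × V → W` (`B (ρ κ v) (ρ κ w) = B v w`, `κ ∈ K`) and
`K`-finite `ρ` in characteristic `0`, the level idempotent is self-adjoint:
`B (e_K v) w = B v (e_K w)` (`levelAverage_left`, `isSelfAdjoint_levelIdempotent`, Mathlib's
`LinearMap.IsSelfAdjoint`); hence `B (e_K v) w = B (e_K v) (e_K w) = B v (e_K w)` and
`V^K ⊥ V(K)` (`levelAverage_sub_levelAverage`): the pairing of a `K`-invariant vector with any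
`w` only sees the `K`-average of `w`.  This is the bookkeeping behind «`∫_K ⟨π(k) v, w⟩ dk =
⟨e_K v, w⟩ = ⟨e_K v, e_K w⟩`» in period computations, stated without Haar measure.  Nothing is
asserted about any specific group.
-/

namespace Summit.Ventures.HodgeRepro2.T5LevelIdempotentAdjoint

open Summit.Ventures.HodgeRepro2.LevelPositivity Summit.Ventures.HodgeRepro2.T5LevelIdempotent

variable {G : Type*} [Group G] {k : Type*} [Field k] {V : Type*} [AddCommGroup V] [Module k V]
  {W : Type*} [AddCommGroup W] [Module k W] (ρ : Representation k G V) {K : Subgroup G}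
  (B : V →ₗ[k] V →ₗ[k] W) (hB : ∀ κ ∈ K, ∀ v w, B (ρ κ v) (ρ κ w) = B v w)

include hB in
/-- Invariance moved to one side: `B (ρ κ v) w = B v (ρ κ⁻¹ w)` for `κ ∈ K`. -/
theorem apply_left_eq_right_inv {κ : G} (hκ : κ ∈ K) (v w : V) :
    B (ρ κ v) w = B v (ρ κ⁻¹ w) := by
  conv_rhs => rw [← hB κ hκ]
  rw [← Module.End.mul_apply (ρ κ) (ρ κ⁻¹), ← map_mul, mul_inv_cancel, map_one,
    Module.End.one_apply]

/-- Reindexing a finite sum over a quotient group by inversion. -/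
theorem sum_inv_quotient {N : Subgroup K} [N.Normal] [Fintype (K ⧸ N)] (f : K ⧸ N → W) :
    ∑ c : K ⧸ N, f c⁻¹ = ∑ c : K ⧸ N, f c :=
  Fintype.sum_equiv (Equiv.inv (K ⧸ N)) _ _ (fun _ => rfl)

include hB in
/-- The level idempotent is self-adjoint for an invariant pairing:
`B (e_K v) w = B v (e_K w)` (finite-index stabilisers, characteristic `0`). -/
theorem levelAverage_left [CharZero k] {v w : V} [(stabilizerIn ρ K v).FiniteIndex]
    [(stabilizerIn ρ K w).FiniteIndex] :
    B (levelAverage ρ K v) w = B v (levelAverage ρ K w) := by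
  haveI : (stabilizerIn ρ K v ⊓ stabilizerIn ρ K w).normalCore.Normal :=
    Subgroup.normalCore_normal _
  haveI : (stabilizerIn ρ K v ⊓ stabilizerIn ρ K w).normalCore.FiniteIndex :=
    Subgroup.finiteIndex_normalCore _
  have hk : ((stabilizerIn ρ K v ⊓ stabilizerIn ρ K w).normalCore.index : k) ≠ 0 :=
    Nat.cast_ne_zero.2 Subgroup.FiniteIndex.index_ne_zero
  have hNv : (stabilizerIn ρ K v ⊓ stabilizerIn ρ K w).normalCore ≤ stabilizerIn ρ K v :=
    (Subgroup.normalCore_le _).trans inf_le_left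
  have hNw : (stabilizerIn ρ K v ⊓ stabilizerIn ρ K w).normalCore ≤ stabilizerIn ρ K w :=
    (Subgroup.normalCore_le _).trans inf_le_right
  letI : Fintype (K ⧸ (stabilizerIn ρ K v ⊓ stabilizerIn ρ K w).normalCore) := Fintype.ofFinite _
  rw [levelAverage_eq hNv hk, levelAverage_eq hNw hk]
  unfold cosetSum
  rw [finsum_eq_sum_of_fintype, finsum_eq_sum_of_fintype, map_smul, LinearMap.smul_apply,
    map_smul, map_sum, LinearMap.sum_apply, map_sum]
  congr 1
  rw [← sum_inv_quotient (K := K) (N := (stabilizerIn ρ K v ⊓ stabilizerIn ρ K w).normalCore)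
    (fun c => B v (ρ ((Quotient.out c : K) : G) w))]
  refine Finset.sum_congr rfl (fun c _ => ?_)
  obtain ⟨κ, rfl⟩ := QuotientGroup.mk_surjective c
  rw [← QuotientGroup.mk_inv, rep_eq hNv κ, rep_eq hNw κ⁻¹, Subgroup.coe_inv]
  exact apply_left_eq_right_inv ρ B hB κ.2 v w

include hB in
/-- `e_K` is self-adjoint for `B` (Mathlib's `LinearMap.IsSelfAdjoint`). -/
theorem isSelfAdjoint_levelIdempotent [CharZero k] (hK : KFinite ρ K) :
    LinearMap.IsSelfAdjoint B (levelIdempotent (ρ := ρ) K hK) := by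
  intro v w
  haveI := hK v
  haveI := hK w
  simp only [levelIdempotent_apply]
  exact levelAverage_left ρ B hB

include hB in
/-- `B (e_K v) w = B (e_K v) (e_K w)`: a `K`-invariant vector pairs with `w` through `e_K w`. -/
theorem levelAverage_left_eq [CharZero k] (hK : KFinite ρ K) (v w : V) :
    B (levelAverage ρ K v) w = B (levelAverage ρ K v) (levelAverage ρ K w) := by
  haveI := hK (levelAverage ρ K v)
  haveI := hK w
  haveI := hK v
  rw [← levelAverage_left ρ B hB, levelAverage_levelAverage]

include hB in
/-- `B v (e_K w) = B (e_K v) (e_K w)`. -/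
theorem levelAverage_right_eq [CharZero k] (hK : KFinite ρ K) (v w : V) :
    B v (levelAverage ρ K w) = B (levelAverage ρ K v) (levelAverage ρ K w) := by
  haveI := hK v
  haveI := hK w
  rw [← levelAverage_left ρ B hB, levelAverage_left_eq ρ B hB hK]

include hB in
/-- A `K`-invariant vector pairs with `w` as with `e_K w`. -/
theorem apply_eq_of_mem_invariants [CharZero k] (hK : KFinite ρ K) {v : V}
    (hv : v ∈ invariants ρ K) (w : V) : B v w = B v (levelAverage ρ K w) := by
  haveI := hK v
  haveI := hK w
  rw [← levelAverage_left ρ B hB, levelAverage_of_mem_invariants hv]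

include hB in
/-- `V^K ⊥ V(K)`: `B (e_K v) (w − e_K w) = 0`. -/
theorem levelAverage_sub_levelAverage [CharZero k] (hK : KFinite ρ K) (v w : V) :
    B (levelAverage ρ K v) (w - levelAverage ρ K w) = 0 := by
  rw [map_sub, levelAverage_left_eq ρ B hB hK, sub_self]

end Summit.Ventures.HodgeRepro2.T5LevelIdempotentAdjoint
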